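import Summits.ResolutionOfSingularities.ResolutionOfSingularities.Theorems.WeightedInvariantHypersurfaceLocalGameEFT4SDimLE
import Summits.ResolutionOfSingularities.ResolutionOfSingularities.Theorems.WeightedInvariantHypersurfaceLocalGameEFT4SDimLETwoRung
import HarnessLib

/-!
# THE P3 TARGET RE-TYPED TO THE DOOR SETTING: the rung `PRungLE d p ι J` / `KeyRungLE d p` with the ι-clauses (c7), (c8),
# (c10) restricted to regular local rings essentially of finite type over a perfect field of characteristic `p` and of
# Krull dimension `≤ d` (door `HypersurfaceCentreConstruction`, stmt-ResolutionOfSingularities-19897, line `local-engine`;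
# registrar res-L1-w43-plan-1 RULING gen 11 #3, 2026-08-27T12:37:46Z, ORDER (o43); typer res-type-098)

The registrar's finding (RULING gen 11 #3): in `PRung d p ι J` (`…HypersurfaceLocalGameEFT4SDimLE`, res-type-061 p522114)
only the three position-dependent clauses (c11) `IotaJEssSmoothCompatibleLE d`, (c9′) `CanonicalGameClauseLE d p`,
(open″) `JOpenPresentationForallSingLE d p` carry the bound `ringKrullDim ≤ d`; the ι-clauses (c7)
`IotaGenerizationMonotone`, (c8) `IotaUpperSemicontinuous`, (c10) `IotaTorusFactorMonotone` quantify over ALL regular local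
rings / ALL smooth quasi-compact schemes over ANY field, in every dimension — and the letter set of record
`ι₃ᵗ = (ν ; ε ; τ ; σ)` (IOTA3-DESIGN v1.3 §8) is dimension-3-specific (the tie bit `τ` is «on» only at Krull dimension 3), so
it cannot satisfy the unrestricted (c8) on fourfolds (registrar's hand specimen `y² + x³z⁹ + x⁷` on `𝔸⁴`).  Hence the P3
TARGET is re-typed, not the letters: this module types

* `IotaGenerizationMonotoneLE d p ι` — (c7)≤d,p: positions = regular local rings essentially of finite type over a perfect
  field of characteristic `p`, of Krull dimension `≤ d`;
* `IotaUpperSemicontinuousLE d p ι` — (c8)≤d,p: smooth quasi-compact `Y` over a perfect field of characteristic `p` all of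
  whose local rings have Krull dimension `≤ d`;
* `IotaTorusFactorMonotoneLE d p ι` — (c10)≤d,p: the torus-factor inequality from positions of dimension `≤ d` (the TARGET
  `S[X]_𝔮` may have dimension `d + 1`; that instance is used);
* `PRungLE d p ι J` — the ten conjuncts in the order of `PRung`, with (c7)(c8)(c10) replaced by their `…LE d p` forms and
  (c11)(c9′)(open″) the existing `…LE d` clauses VERBATIM; `KeyRungLE d p := ∃ ι J, PRungLE d p ι J`;
* seams (sorry-free plumbing): `iotaGenerizationMonotoneLE_of` / `iotaUpperSemicontinuousLE_of` /
  `iotaTorusFactorMonotoneLE_of` (unrestricted ⇒ restricted), `…LE_mono` (antitone in `d`), `pRungLE_of_pRung`,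
  `keyRungLE_of_dimLE`, `keyRungLE_of_eft4S` (the KEY still implies the rung — it stays an honest rung of the KEY's ladder:
  «the engine for threefolds over perfect fields of characteristic `p`»), `pRungLE_mono`, `keyRungLE_mono`, `keyRungLE_two`
  (from the landed P2 rung `stub_keyRung_dimLETwo`, res-type-073 p521487), `keyRungLE_three_of_pair` (the concluder seam
  of the registrar's skeleton v3.8 stub `stub_keyRungLE_three : ∀ p, p.Prime → KeyRungLE 3 p`).

Definitions and plumbing only; NO mathematics.  [OURS · candidates · conjecture-grade design objects; nothing here asserts
anything about Hironaka's problem; NOT a statement of the manuscript under review (Hironaka 2017,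
[claim: Hironaka2017, status: under-review]); AI planning/typing, weaker than expert review.]

## References

* res-L1-w43-plan-1, RULING gen 11 #3 (HOME/STATUS 2026-08-27T12:37:46Z) and `L/res-L1-w43-plan-1/IOTA3-DESIGN.md` v1.3 §8
  (OURS, AI planning).
* V. Cossart, U. Jannsen, S. Saito, *Desingularization: invariants and strategy*, LNM 2270 (2020), Ch. 2 (Hilbert–Samuel
  strata; the shape of dimension-bounded invariants). [CossartJannsenSaito2020]
-/

set_option linter.dupNamespace false

noncomputable section

open IsLocalRing Literature.AlgebraicGeometry.Resolution
open AlgebraicGeometry CategoryTheory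

namespace Summit.ResolutionOfSingularities.ResolutionOfSingularities.Cruxes.HypersurfaceCentreConstruction.LocalEngine

/-! ## The three ι-clauses restricted to the door setting at Krull dimension `≤ d` -/

/-- (c7)≤d,p: `ι` does not increase under generization (localisation at a prime) of a REGULAR local ring essentially of
finite type over a perfect field of characteristic `p`, of Krull dimension `≤ d`.  At `d, p` unrestricted this is
`IotaGenerizationMonotone` (`iotaGenerizationMonotoneLE_of`). [OURS · candidate clause of the rung `PRungLE d p` ·
registrar res-L1-w43-plan-1, RULING gen 11 #3, ORDER (o43)] -/
def IotaGenerizationMonotoneLE (d p : ℕ) (ι : (R : Type) → [CommRing R] → R → Ordinal.{0}) : Prop :=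
  ∀ (k₀ : Type) [Field k₀] [CharP k₀ p] [PerfectField k₀]
    (S : Type) [CommRing S] [Algebra k₀ S] [Algebra.EssFiniteType k₀ S] [IsRegularLocalRing S]
    (𝔭 : Ideal S) [𝔭.IsPrime] (f : S), ringKrullDim S ≤ d →
    ι (Localization.AtPrime 𝔭) (algebraMap S (Localization.AtPrime 𝔭) f) ≤ ι S f

/-- (c8)≤d,p: `ι` is upper semicontinuous along SMOOTH quasi-compact schemes over a PERFECT field of characteristic `p`
all of whose local rings have Krull dimension `≤ d`: every super-level set of `y ↦ ι 𝒪_{Y,y} f_y` is closed.  At `d, p`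
unrestricted (any field) this is `IotaUpperSemicontinuous` (`iotaUpperSemicontinuousLE_of`). [OURS · candidate clause of the
rung `PRungLE d p` · registrar res-L1-w43-plan-1, RULING gen 11 #3, ORDER (o43)] -/
def IotaUpperSemicontinuousLE (d p : ℕ) (ι : (R : Type) → [CommRing R] → R → Ordinal.{0}) : Prop :=
  ∀ (k₀ : Type) [Field k₀] [CharP k₀ p] [PerfectField k₀]
    (Y : Scheme.{0}) (hY : Y ⟶ Spec (CommRingCat.of k₀)) [Smooth hY] [QuasiCompact hY],
    (∀ y : ↥Y, ringKrullDim (Y.presheaf.stalk y) ≤ d) →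
    ∀ (f : Γ(Y, ⊤)) (α : Ordinal.{0}),
      IsClosed {y : ↥Y | α ≤ ι (Y.presheaf.stalk y) (Y.presheaf.germ ⊤ y trivial f)}

/-- (c10)≤d,p: `ι` does not increase when passing from a position `(S, f)` of Krull dimension `≤ d` (regular local,
essentially of finite type over a perfect field of characteristic `p`) to the local rings of `S[X]` over the closed point
(the TARGET `S[X]_𝔮` may have dimension `d + 1` — that instance is used: the drop at the closed points of an orbit curve is
the orbit-generic drop plus this inequality).  At `d, p` unrestricted this is `IotaTorusFactorMonotone`
(`iotaTorusFactorMonotoneLE_of`). [OURS · candidate clause of the rung `PRungLE d p` · registrar res-L1-w43-plan-1,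
RULING gen 11 #3, ORDER (o43)] -/
def IotaTorusFactorMonotoneLE (d p : ℕ) (ι : (R : Type) → [CommRing R] → R → Ordinal.{0}) : Prop :=
  ∀ (k₀ : Type) [Field k₀] [CharP k₀ p] [PerfectField k₀]
    (S : Type) [CommRing S] [Algebra k₀ S] [Algebra.EssFiniteType k₀ S] [IsRegularLocalRing S]
    (f : S) (𝔮 : Ideal (Polynomial S)) [𝔮.IsPrime], ringKrullDim S ≤ d →
    𝔮.comap (Polynomial.C : S →+* Polynomial S) = IsLocalRing.maximalIdeal S →
    ι (Localization.AtPrime 𝔮) (algebraMap (Polynomial S) (Localization.AtPrime 𝔮) (Polynomial.C f)) ≤ ι S f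

/-! ## The rung `PRungLE d p` and its ∃-closure `KeyRungLE d p` -/

/-- THE RUNG OF THE KEY'S LADDER IN THE DOOR SETTING AT KRULL DIMENSION `≤ d`: the ten clauses of `LocalWeightedDropEFT4S p`
for a pair `(ι, J)`, in the order of `PRung d p ι J`, with the ι-clauses (c7), (c8), (c10) in their door-setting forms
`…LE d p` and the position-dependent clauses (c11), (c9′), (open″) the existing `…LE d` clauses verbatim.  `PRung d p ι J`
implies it (`pRungLE_of_pRung`); `d = 3` is the registrar's P3 target after RULING gen 11 #3 («the engine for threefolds
over perfect fields of characteristic `p`»). [OURS · candidate · registrar res-L1-w43-plan-1, ORDER (o43)] -/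
def PRungLE (d p : ℕ) (ι : (R : Type) → [CommRing R] → R → Ordinal.{0})
    (J : (R : Type) → [CommRing R] → R → ℕ → Ideal R) : Prop :=
  IotaIsoInvariant ι ∧ IotaGenerizationMonotoneLE d p ι ∧ IotaUpperSemicontinuousLE d p ι ∧
  IotaTorusFactorMonotoneLE d p ι ∧ JIsoInvariant J ∧ IotaJEssSmoothCompatibleLE d ι J ∧ CanonicalGameClauseLE d p ι J ∧
  JOpenPresentationForallSingLE d p ι J ∧ IotaUnitInvariant ι ∧ JUnitInvariant J

/-- THE ∃-CLOSED RUNG IN THE DOOR SETTING AT KRULL DIMENSION `≤ d`: some pair `(ι, J)` satisfies `PRungLE d p ι J`.  Implied by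
the KEY `LocalWeightedDropEFT4S p` (`keyRungLE_of_eft4S`) and by the unrestricted rung `LocalWeightedDropEFT4SDimLE d p`
(`keyRungLE_of_dimLE`); antitone in `d` (`keyRungLE_mono`); `d = 2` holds (`keyRungLE_two`, from the landed P2 rung).  The
registrar's skeleton v3.8 stub is `stub_keyRungLE_three : ∀ p, p.Prime → KeyRungLE 3 p` (concluder seam
`keyRungLE_three_of_pair`). [OURS · candidate · registrar res-L1-w43-plan-1, ORDER (o43)] -/
def KeyRungLE (d p : ℕ) : Prop :=
  ∃ (ι : (R : Type) → [CommRing R] → R → Ordinal.{0}) (J : (R : Type) → [CommRing R] → R → ℕ → Ideal R),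
    PRungLE d p ι J

/-! ## Seams (sorry-free plumbing) -/

section Seams

variable {ι : (R : Type) → [CommRing R] → R → Ordinal.{0}} {J : (R : Type) → [CommRing R] → R → ℕ → Ideal R}

/-- Unrestricted (c7) gives (c7)≤d,p. [OURS · seam · ORDER (o43)] -/
theorem iotaGenerizationMonotoneLE_of (d p : ℕ) (h : IotaGenerizationMonotone ι) :
    IotaGenerizationMonotoneLE d p ι := by
  intro k₀ _ _ _ S _ _ _ _ 𝔭 _ f _
  exact h S 𝔭 f

/-- Unrestricted (c8) gives (c8)≤d,p. [OURS · seam · ORDER (o43)] -/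
theorem iotaUpperSemicontinuousLE_of (d p : ℕ) (h : IotaUpperSemicontinuous ι) :
    IotaUpperSemicontinuousLE d p ι := by
  intro k₀ _ _ _ Y hY _ _ _ f α
  exact h k₀ Y hY f α

/-- Unrestricted (c10) gives (c10)≤d,p. [OURS · seam · ORDER (o43)] -/
theorem iotaTorusFactorMonotoneLE_of (d p : ℕ) (h : IotaTorusFactorMonotone ι) :
    IotaTorusFactorMonotoneLE d p ι := by
  intro k₀ _ _ _ S _ _ _ _ f 𝔮 _ _ h𝔮
  exact h S f 𝔮 h𝔮

/-- (c7)≤d,p is antitone in `d`. [OURS · seam · ORDER (o43)] -/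
theorem iotaGenerizationMonotoneLE_mono {d d' : ℕ} (hdd' : d ≤ d') (p : ℕ)
    (h : IotaGenerizationMonotoneLE d' p ι) : IotaGenerizationMonotoneLE d p ι := by
  intro k₀ _ _ _ S _ _ _ _ 𝔭 _ f hdim
  exact h k₀ S 𝔭 f (hdim.trans (by exact_mod_cast hdd'))

/-- (c8)≤d,p is antitone in `d`. [OURS · seam · ORDER (o43)] -/
theorem iotaUpperSemicontinuousLE_mono {d d' : ℕ} (hdd' : d ≤ d') (p : ℕ)
    (h : IotaUpperSemicontinuousLE d' p ι) : IotaUpperSemicontinuousLE d p ι := by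
  intro k₀ _ _ _ Y hY _ _ hdim f α
  exact h k₀ Y hY (fun y => (hdim y).trans (by exact_mod_cast hdd')) f α

/-- (c10)≤d,p is antitone in `d`. [OURS · seam · ORDER (o43)] -/
theorem iotaTorusFactorMonotoneLE_mono {d d' : ℕ} (hdd' : d ≤ d') (p : ℕ)
    (h : IotaTorusFactorMonotoneLE d' p ι) : IotaTorusFactorMonotoneLE d p ι := by
  intro k₀ _ _ _ S _ _ _ _ f 𝔮 _ hdim h𝔮
  exact h k₀ S f 𝔮 (hdim.trans (by exact_mod_cast hdd')) h𝔮

variable (ι J)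

/-- **The unrestricted rung gives the door-setting rung**: `PRung d p ι J → PRungLE d p ι J`.
[OURS · seam · ORDER (o43)] -/
theorem pRungLE_of_pRung (d p : ℕ) (h : PRung d p ι J) : PRungLE d p ι J := by
  obtain ⟨h1, h2, h3, h4, h5, h6, h7, h8, h9, h10⟩ := h
  exact ⟨h1, iotaGenerizationMonotoneLE_of d p h2, iotaUpperSemicontinuousLE_of d p h3,
    iotaTorusFactorMonotoneLE_of d p h4, h5, h6, h7, h8, h9, h10⟩

/-- **The door-setting ladder is antitone**: rung `d'` gives rung `d` for `d ≤ d'`. [OURS · seam · ORDER (o43)] -/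
theorem pRungLE_mono {d d' : ℕ} (hdd' : d ≤ d') (p : ℕ) (h : PRungLE d' p ι J) : PRungLE d p ι J := by
  obtain ⟨h1, h2, h3, h4, h5, h6, h7, h8, h9, h10⟩ := h
  exact ⟨h1, iotaGenerizationMonotoneLE_mono hdd' p h2, iotaUpperSemicontinuousLE_mono hdd' p h3,
    iotaTorusFactorMonotoneLE_mono hdd' p h4, h5, iotaJEssSmoothCompatibleLE_mono hdd' ι J h6,
    canonicalGameClauseLE_mono hdd' p ι J h7, jOpenPresentationForallSingLE_mono hdd' p ι J h8, h9, h10⟩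

variable {ι J}

/-- The unrestricted ∃-closed rung gives the door-setting one. [OURS · seam · ORDER (o43)] -/
theorem keyRungLE_of_dimLE (d p : ℕ) (h : LocalWeightedDropEFT4SDimLE d p) : KeyRungLE d p := by
  obtain ⟨ι, J, hr⟩ := h
  exact ⟨ι, J, pRungLE_of_pRung ι J d p hr⟩

/-- **The KEY implies the door-setting rung at every dimension bound** (it stays an honest rung of the KEY's ladder).
[OURS · seam · ORDER (o43)] -/
theorem keyRungLE_of_eft4S (d p : ℕ) (h : LocalWeightedDropEFT4S p) : KeyRungLE d p :=
  keyRungLE_of_dimLE d p (localWeightedDropEFT4SDimLE_of_eft4S d p h)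

/-- The door-setting ∃-closed rung is antitone in `d`. [OURS · seam · ORDER (o43)] -/
theorem keyRungLE_mono {d d' : ℕ} (hdd' : d ≤ d') (p : ℕ) (h : KeyRungLE d' p) : KeyRungLE d p := by
  obtain ⟨ι, J, hr⟩ := h
  exact ⟨ι, J, pRungLE_mono ι J hdd' p hr⟩

/-- **`KeyRungLE 2 p` for every prime `p`**, from the landed P2 rung `stub_keyRung_dimLETwo` (res-type-073 p521487:
`P2Rung p iotaOrd jContact`) via `pRung_two_iff` and restriction. [OURS · seam · ORDER (o43)] -/
theorem keyRungLE_two : ∀ p : ℕ, p.Prime → KeyRungLE 2 p := fun p hp =>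
  ⟨iotaOrd, jContact, pRungLE_of_pRung iotaOrd jContact 2 p ((pRung_two_iff p iotaOrd jContact).mpr
    (stub_keyRung_dimLETwo p hp))⟩

/-- **Concluder seam of the registrar's v3.8 stub** `stub_keyRungLE_three : ∀ p, p.Prime → KeyRungLE 3 p`: a NAMED pair
`(ι, J)` satisfying `PRungLE 3 p ι J` for every prime closes it. [OURS · seam · ORDER (o43)] -/
theorem keyRungLE_three_of_pair (ι : (R : Type) → [CommRing R] → R → Ordinal.{0})
    (J : (R : Type) → [CommRing R] → R → ℕ → Ideal R) (h : ∀ p : ℕ, p.Prime → PRungLE 3 p ι J) :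
    ∀ p : ℕ, p.Prime → KeyRungLE 3 p := fun p hp =>
  ⟨ι, J, h p hp⟩

/-- The `d`-parametric concluder seam. [OURS · seam · ORDER (o43)] -/
theorem keyRungLE_of_pair (d : ℕ) (ι : (R : Type) → [CommRing R] → R → Ordinal.{0})
    (J : (R : Type) → [CommRing R] → R → ℕ → Ideal R) (h : ∀ p : ℕ, p.Prime → PRungLE d p ι J) :
    ∀ p : ℕ, p.Prime → KeyRungLE d p := fun p hp =>
  ⟨ι, J, h p hp⟩

end Seams

end Summit.ResolutionOfSingularities.ResolutionOfSingularities.Cruxes.HypersurfaceCentreConstruction.LocalEngine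

end
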